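import Mathlib.Analysis.SpecialFunctions.Gaussian.GaussianIntegral
import Mathlib.Analysis.SpecialFunctions.Gaussian.FourierTransform
import Mathlib.Analysis.Complex.ExponentialBounds
import Mathlib.Analysis.Real.Pi.Bounds
import Literature.Geometry.Riemannian.ThreeShrinkerClassification
import Literature.Geometry.Riemannian.GaussianShrinker
import HarnessLib

/-!
# The model constants and the Gaussian model of the three-dimensional shrinker classification

Companion of `ThreeShrinkerClassification.lean`, whose named fact
`Literature.Geometry.Riemannian.threeShrinkerClassification_modelData` exports the classification
of complete three-dimensional gradient shrinking Ricci solitons (Munteanu–Wang, arXiv:1606.01861,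
Thm. 1.2, citing Ivey, Perelman, Naber, Ni–Wallach, Cao–Chen–Zhu) as the model data of a
normalised shrinker: case (o) `ℝ³`, `∫ e^{-φ} = 8π√π`; (a) `S³(2)/Γ`, `Vol = 16π²/k`;
(b) `S²(√2) × ℝ`, `∫ e^{-φ} = 16π√π e^{-1}`; (c) its `ℤ₂`-quotients, `8π√π e^{-1}`.

Proved here (no named facts; everything from Mathlib and the tree's proved Euclidean model
`GaussianShrinker.lean`):

* `ThreeShrinker.integral_exp_neg_sub_sq_div_four`, `….integral_exp_neg_norm_sub_sq_div_four`
  (and `lintegral` forms): the Gaussian integrals `∫_ℝ e^{-(z-a)²/4} dz = 2√π` and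
  `∫_{ℝ³} e^{-|x-a|²/4} dx = (4π)^{3/2} = 8π√π` — the real-analysis leaves of derivations (o), (b);
* the closed forms `16π√π e^{-1}` (cylinder, from `Area(S²(√2)) = 8π` and Fubini), `8π√π e^{-1}`,
  `16π²/k`, and their comparison with the sphere value `16π² e^{-3/2}` (`e < π`), which is what
  the first user of the fact (`stub_threeShrinkerGap_of_classification`, Summits/SmoothPoincare4)
  consumes;
* `ThreeShrinker.riemannianMeasure_euclideanMetric`: the tree's Riemannian measure
  (`Lorentzian.riemannianMeasure`, Euclidean-normalised Hausdorff measure of the length metric) of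
  a Euclidean space of any finite dimension is Lebesgue measure (Federer 1969, §3.2.46, flat
  case; `GaussianShrinker.riemannianMeasure_euclideanFour` is `ℝ⁴`);
* `ThreeShrinker.gaussianSoliton_three_hypotheses`, `….gaussianSoliton_three_modelData`: the
  Gaussian soliton `(ℝ³, δ, |x|²/4)` written in the fact's own binder satisfies its four
  hypotheses (so the fact is not vacuous) and conclusion (o) with exactly the stated constant
  (Cao–Hamilton–Ilmanen 2004, §§3–4: `Θ(ℝⁿ) = 1`).

What is NOT here: the classification itself — B.-L. Chen's `Sect ≥ 0` for three-dimensional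
shrinkers, Hamilton's strong maximum principle and splitting, the Ni–Wallach / Cao–Chen–Zhu
rigidity of the noncompact case, Ivey's theorem in the compact case, Hamilton's two-dimensional
classification — none of which is in the tree (Killing–Hopf is:
`isSphericalSpaceForm_of_constantCurvature`); the fact stays a named fact.

## References

* O. Munteanu, J. Wang, *Structure at infinity for shrinking Ricci solitons*, arXiv:1606.01861,
  Thm. 1.2 (p. 3). [MunteanuWang2016]
* H.-D. Cao, R. S. Hamilton, T. Ilmanen, *Gaussian densities and stability for some Ricci
  solitons*, arXiv:math/0404165 (2004), §§3–4. [CaoHamiltonIlmanen2004]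
* H. Federer, *Geometric Measure Theory* (1969), §2.10.2, §3.2.46.
-/

noncomputable section

namespace Literature.Geometry.Riemannian

open _root_.MeasureTheory Set
open scoped Manifold ContDiff ENNReal NNReal
open Literature.Geometry.Lorentzian

/-! ## Arithmetic of the model constants

The closed forms `8π√π`, `16π²/k`, `16π√π e^{-1}`, `8π√π e^{-1}` of the four cases are the values
of explicit Gaussian integrals and sphere volumes on the model spaces (docstring of
`threeShrinkerClassification_modelData`, derivations (o), (a), (b), (c)). The real-analysis part
of those derivations is recorded here, proved from Mathlib's Gaussian integrals
(`integral_gaussian`, `GaussianFourier.integral_rexp_neg_mul_sq_norm`): the leaves of the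
eventual proof, reached after the isometric identification with the model and the uniqueness of
the normalised potential. Grouped under `ThreeShrinker`. -/

namespace ThreeShrinker

open Real

/-- `√(4π) = 2√π`. [folklore] -/
theorem sqrt_four_mul_pi : sqrt (4 * π) = 2 * sqrt π := by
  rw [Real.sqrt_mul (by norm_num : (0 : ℝ) ≤ 4), show (4 : ℝ) = 2 ^ 2 by norm_num,
    Real.sqrt_sq (by norm_num : (0 : ℝ) ≤ 2)]

/-- **The Gaussian normalisation in dimension three**: `(4π)^{3/2} = 8π√π` (the constant of
case (o), `∫_{ℝ³} e^{-|x|²/4} dx = (4π)^{3/2}`; Cao–Hamilton–Ilmanen 2004, §3). [folklore] -/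
theorem four_pi_rpow_three_halves : (4 * π) ^ ((3 : ℝ) / 2) = 8 * π * sqrt π := by
  have hpos : 0 < 4 * π := by positivity
  rw [show (3 : ℝ) / 2 = 1 + 1 / 2 by norm_num, Real.rpow_add hpos, Real.rpow_one,
    ← Real.sqrt_eq_rpow, sqrt_four_mul_pi]
  ring

/-- **The one-dimensional Gaussian of the cylinder potential**: `∫_ℝ e^{-z²/4} dz = 2√π`
(derivation (b): the line factor of `∫_{S²(√2)×ℝ} e^{-φ}`). [folklore] -/
theorem integral_exp_neg_sq_div_four : ∫ z : ℝ, exp (-(z ^ 2 / 4)) = 2 * sqrt π := by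
  have hfun : (fun z : ℝ ↦ exp (-(z ^ 2 / 4))) = fun z ↦ exp (-(1 / 4) * z ^ 2) := by
    funext z; ring_nf
  rw [hfun, integral_gaussian (1 / 4), show π / (1 / 4) = 4 * π by ring, sqrt_four_mul_pi]

/-- Translated form: `∫_ℝ e^{-(z-a)²/4} dz = 2√π` for every centre `a` (the normalised cylinder
potential is `φ = (z - a)²/4 + 1`). [folklore] -/
theorem integral_exp_neg_sub_sq_div_four (a : ℝ) :
    ∫ z : ℝ, exp (-((z - a) ^ 2 / 4)) = 2 * sqrt π := by
  rw [integral_sub_right_eq_self (μ := volume) (fun z : ℝ ↦ exp (-(z ^ 2 / 4))) a]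
  exact integral_exp_neg_sq_div_four

/-- **The Gaussian integral on `ℝ³`**: `∫_{ℝ³} e^{-|x|²/4} dx = (4π)^{3/2} = 8π√π` (the weighted
volume of the Gaussian soliton, case (o); Cao–Hamilton–Ilmanen 2004, §3, `Θ(ℝⁿ) = 1`). [folklore] -/
theorem integral_exp_neg_norm_sq_div_four :
    ∫ x : EuclideanSpace ℝ (Fin 3), exp (-(‖x‖ ^ 2 / 4)) = 8 * π * sqrt π := by
  have h := GaussianFourier.integral_rexp_neg_mul_sq_norm (V := EuclideanSpace ℝ (Fin 3))
    (b := 1 / 4) (by norm_num)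
  have hfun : (fun x : EuclideanSpace ℝ (Fin 3) ↦ exp (-(‖x‖ ^ 2 / 4))) =
      fun x ↦ exp (-(1 / 4) * ‖x‖ ^ 2) := by
    funext x; ring_nf
  rw [hfun, h, finrank_euclideanSpace_fin, show π / (1 / 4) = 4 * π by ring,
    show ((3 : ℕ) : ℝ) / 2 = (3 : ℝ) / 2 by norm_num, four_pi_rpow_three_halves]

/-- Translated form: `∫_{ℝ³} e^{-|x-a|²/4} dx = 8π√π` for every centre `a` (the normalised
Gaussian potential is `φ = |x - a|²/4`). [folklore] -/
theorem integral_exp_neg_norm_sub_sq_div_four (a : EuclideanSpace ℝ (Fin 3)) :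
    ∫ x : EuclideanSpace ℝ (Fin 3), exp (-(‖x - a‖ ^ 2 / 4)) = 8 * π * sqrt π := by
  rw [integral_sub_right_eq_self (μ := volume)
    (fun x : EuclideanSpace ℝ (Fin 3) ↦ exp (-(‖x‖ ^ 2 / 4))) a]
  exact integral_exp_neg_norm_sq_div_four

/-- The Gaussian integral on `ℝ³` as a lower Lebesgue integral, the form in which the weighted
volume `∫⁻ e^{-φ} dV` appears in `threeShrinkerClassification_modelData`, case (o):
`∫⁻_{ℝ³} e^{-|x-a|²/4} dx = 8π√π`. [folklore] -/
theorem lintegral_exp_neg_norm_sub_sq_div_four (a : EuclideanSpace ℝ (Fin 3)) :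
    ∫⁻ x : EuclideanSpace ℝ (Fin 3), ENNReal.ofReal (exp (-(‖x - a‖ ^ 2 / 4))) =
      ENNReal.ofReal (8 * π * sqrt π) := by
  have hint : Integrable (fun x : EuclideanSpace ℝ (Fin 3) ↦ exp (-(‖x - a‖ ^ 2 / 4))) :=
    Integrable.of_integral_ne_zero (by rw [integral_exp_neg_norm_sub_sq_div_four]; positivity)
  rw [← integral_exp_neg_norm_sub_sq_div_four a, ofReal_integral_eq_lintegral_ofReal hint
    (ae_of_all _ fun x ↦ (exp_pos _).le)]

/-- The one-dimensional Gaussian as a lower Lebesgue integral: `∫⁻_ℝ e^{-(z-a)²/4} dz = 2√π`.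
[folklore] -/
theorem lintegral_exp_neg_sub_sq_div_four (a : ℝ) :
    ∫⁻ z : ℝ, ENNReal.ofReal (exp (-((z - a) ^ 2 / 4))) = ENNReal.ofReal (2 * sqrt π) := by
  have hint : Integrable (fun z : ℝ ↦ exp (-((z - a) ^ 2 / 4))) :=
    Integrable.of_integral_ne_zero (by rw [integral_exp_neg_sub_sq_div_four]; positivity)
  rw [← integral_exp_neg_sub_sq_div_four a, ofReal_integral_eq_lintegral_ofReal hint
    (ae_of_all _ fun z ↦ (exp_pos _).le)]

/-- **The cylinder constant** (derivation (b)): with `Area(S²(√2)) = 4π(√2)² = 8π` and the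
normalised potential `φ = (z-a)²/4 + 1`, Fubini gives
`∫_{S²(√2)×ℝ} e^{-φ} = Area(S²(√2)) · e^{-1} · ∫_ℝ e^{-(z-a)²/4} dz = 16π√π e^{-1}`. [folklore] -/
theorem cylinder_weightedVolume (a : ℝ) :
    4 * π * sqrt 2 ^ 2 * (exp (-1) * ∫ z : ℝ, exp (-((z - a) ^ 2 / 4))) =
      16 * π * sqrt π * exp (-1) := by
  rw [integral_exp_neg_sub_sq_div_four, Real.sq_sqrt (by norm_num : (0 : ℝ) ≤ 2)]
  ring

/-- **The `ℤ₂`-quotient constant** (derivation (c)): half the cylinder's weighted volume is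
`8π√π e^{-1}`. [folklore] -/
theorem cylinderQuotient_weightedVolume :
    16 * π * sqrt π * exp (-1) / 2 = 8 * π * sqrt π * exp (-1) := by
  ring

/-- **The space-form constant** (derivation (a)): `Vol(S³(2)) = Vol(S³(1)) · 2³ = 2π² · 8 = 16π²`,
and `Vol(S³(2)/Γ) = 16π²/k` for `|Γ| = k`. [folklore] -/
theorem sphere_two_volume (k : ℕ) : 2 * π ^ 2 * 2 ^ 3 / k = 16 * π ^ 2 / k := by
  ring

/-- `e < π` (`e < 2.7182818286 < 3 < π`). [folklore] -/
theorem exp_one_lt_pi : exp 1 < π := by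
  have h1 : exp 1 < 2.7182818286 := Real.exp_one_lt_d9
  have h2 : (3 : ℝ) < π := Real.pi_gt_three
  linarith

/-- `√π · e^{-1} < π · e^{-3/2}`, i.e. `e^{1/2} < √π`: the comparison behind
`16π√π e^{-1} < 16π² e^{-3/2}`. [folklore] -/
theorem sqrt_pi_mul_exp_neg_one_lt : sqrt π * exp (-1) < π * exp (-(3 : ℝ) / 2) := by
  have hπ : 0 < π := Real.pi_pos
  -- `e^{1/2} < √π` from `e < π`
  have hhalf : exp (1 / 2) < sqrt π := by
    have h2 : exp (1 / 2) ^ 2 = exp 1 := by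
      rw [← Real.exp_nat_mul]; norm_num
    have hlt : exp (1 / 2) ^ 2 < sqrt π ^ 2 := by
      rw [h2, Real.sq_sqrt hπ.le]; exact exp_one_lt_pi
    exact lt_of_pow_lt_pow_left₀ 2 (Real.sqrt_nonneg _) hlt
  -- factor `√π e^{-3/2} > 0` out of both sides
  have key : sqrt π * exp (-1) = sqrt π * exp (-(3 : ℝ) / 2) * exp (1 / 2) := by
    rw [mul_assoc, ← Real.exp_add]; norm_num
  have key2 : π * exp (-(3 : ℝ) / 2) = sqrt π * exp (-(3 : ℝ) / 2) * sqrt π := by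
    rw [mul_comm (sqrt π * _) _, ← mul_assoc, Real.mul_self_sqrt hπ.le]
  rw [key, key2]
  exact mul_lt_mul_of_pos_left hhalf (by positivity)

/-- **The cylinder lies strictly below the sphere value**: `16π√π e^{-1} < 16π² e^{-3/2}`
(numerically `32.78 < 35.24`; in Gaussian densities `Θ(S²×ℝ) ≈ .736 < Θ(S³) ≈ .791`,
Cao–Hamilton–Ilmanen 2004, §3) — the inequality the first user of the fact
(`stub_threeShrinkerGap_of_classification`) needs in case (b). [folklore] -/
theorem cylinder_lt_sphere_bound :
    16 * π * sqrt π * exp (-1) < 16 * π ^ 2 * exp (-(3 : ℝ) / 2) := by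
  have h := sqrt_pi_mul_exp_neg_one_lt
  have hπ : 0 < π := Real.pi_pos
  calc 16 * π * sqrt π * exp (-1) = 16 * π * (sqrt π * exp (-1)) := by ring
    _ < 16 * π * (π * exp (-(3 : ℝ) / 2)) := mul_lt_mul_of_pos_left h (by positivity)
    _ = 16 * π ^ 2 * exp (-(3 : ℝ) / 2) := by ring

/-- The `ℤ₂`-quotients lie below the sphere value as well: `8π√π e^{-1} < 16π² e^{-3/2}`
(case (c)). [folklore] -/
theorem cylinderQuotient_lt_sphere_bound :
    8 * π * sqrt π * exp (-1) < 16 * π ^ 2 * exp (-(3 : ℝ) / 2) := by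
  have h := cylinder_lt_sphere_bound
  have hnn : 0 ≤ 8 * π * sqrt π * exp (-1) := by positivity
  linarith

/-- The space forms satisfy the sphere bound: `(16π²/k) e^{-3/2} ≤ 16π² e^{-3/2}` for `k ≥ 1`
(case (a); equality exactly for the round `S³(2)`, `k = 1`). [folklore] -/
theorem spaceForm_le_sphere_bound {k : ℕ} (hk : 0 < k) :
    16 * π ^ 2 / k * exp (-(3 : ℝ) / 2) ≤ 16 * π ^ 2 * exp (-(3 : ℝ) / 2) := by
  have hk1 : (1 : ℝ) ≤ k := by exact_mod_cast hk
  have hle : 16 * π ^ 2 / k ≤ 16 * π ^ 2 := div_le_self (by positivity) hk1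
  exact mul_le_mul_of_nonneg_right hle (exp_pos _).le

end ThreeShrinker

/-! ## The Gaussian model in dimension three

Case (o) is realised, with exactly the stated constant, by the Gaussian soliton
`(ℝ³, δ, |x|²/4)` written in the binder of `threeShrinkerClassification_modelData`
(`N = EuclideanSpace ℝ (Fin 3)` modelled on itself, `h = euclideanMetric`, `φ = gaussianPotential`
of `GaussianShrinker.lean`): the four hypotheses hold (`gaussianSoliton_three_hypotheses`, so the
fact is not vacuous) and the conclusion (o) holds (`gaussianSoliton_three_modelData`). The one new
ingredient over `GaussianShrinker.lean` (which treats `ℝ⁴`) is the identification of the tree's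
Riemannian measure of a Euclidean space of any dimension with Lebesgue measure,
`riemannianMeasure_euclideanMetric` — the last step of derivation (o) after the isometry with the
model. -/

namespace ThreeShrinker

open Real MeasureTheory Measure
open scoped RealInnerProductSpace

/-- On a finite-dimensional inner product space, the Euclidean-normalised Hausdorff measure of
dimension `dim V` of ANY emetric structure `i` whose distance is the norm distance is Lebesgue
measure (`volume`): transport of `μHE` along the identity (Federer 1969, §2.10.2) and Mathlib's
`InnerProductSpace.euclideanHausdorffMeasure_eq_volume`. (The norm distance is written
`↑(nndist x y)` so that it does not refer to `i`.) [folklore] -/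
theorem euclideanHausdorffMeasure_eq_volume_of_edist_eq {V : Type*} [NormedAddCommGroup V]
    [InnerProductSpace ℝ V] [FiniteDimensional ℝ V] [MeasurableSpace V] [BorelSpace V]
    (i : EMetricSpace V)
    (b : @BorelSpace V (@UniformSpace.toTopologicalSpace V
      (@PseudoEMetricSpace.toUniformSpace V (@EMetricSpace.toPseudoEMetricSpace V i))) _)
    (h : ∀ x y : V, @edist V (@PseudoEMetricSpace.toEDist V
      (@EMetricSpace.toPseudoEMetricSpace V i)) x y = (nndist x y : ENNReal)) :
    @euclideanHausdorffMeasure V i _ b (Module.finrank ℝ V) = (volume : Measure V) := by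
  rw [← InnerProductSpace.euclideanHausdorffMeasure_eq_volume (V := V)]
  refine Measure.ext fun s _ ↦ ?_
  have hstd := @euclideanHausdorffMeasure_def V MetricSpace.toEMetricSpace _
    (by exact inferInstanceAs (BorelSpace V)) (Module.finrank ℝ V)
  rw [@euclideanHausdorffMeasure_def V i _ b, hstd, Measure.smul_apply, Measure.smul_apply,
    hausdorffMeasure_eq_of_edist_eq i MetricSpace.toEMetricSpace b
      (by exact inferInstanceAs (BorelSpace V))
      (fun x y ↦ by rw [h x y]; exact edist_nndist x y) (Nat.cast_nonneg _) s]

/-- **The Riemannian measure of a Euclidean space is Lebesgue measure** (`dV_δ = dx`, any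
finite dimension; Federer 1969, §3.2.46 in the flat case): the tree's `riemannianMeasure` of
`euclideanMetric V` is `volume`. (`GaussianShrinker.riemannianMeasure_euclideanFour` is the case
`V = ℝ⁴`.) [folklore] -/
theorem riemannianMeasure_euclideanMetric (V : Type*) [NormedAddCommGroup V]
    [InnerProductSpace ℝ V] [FiniteDimensional ℝ V] [MeasurableSpace V] [BorelSpace V] :
    riemannianMeasure ((euclideanMetric V).toContMDiffRiemannianMetric
      isRiemannian_euclideanMetric) = (volume : Measure V) := by
  refine euclideanHausdorffMeasure_eq_volume_of_edist_eq _ _ fun x y ↦ ?_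
  rw [← edist_nndist, IsRiemannianManifold.out (I := 𝓘(ℝ, V)) x y]
  rfl

/-- **The Gaussian soliton `(ℝ³, δ, |x|²/4)` satisfies the four hypotheses of
`threeShrinkerClassification_modelData`** (non-vacuity of the fact): closed distance balls are
compact, the potential is smooth, `Ric + Hess φ = ½ δ` and `R + |∇φ|² = φ`
(Cao–Hamilton–Ilmanen 2004, §4, (1); `GaussianShrinker.lean` in dimension three).
[cite: CaoHamiltonIlmanen2004, §4] -/
theorem gaussianSoliton_three_hypotheses :
    (∀ (x : EuclideanSpace ℝ (Fin 3)) (r : NNReal),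
      IsCompact {y : EuclideanSpace ℝ (Fin 3) |
        (euclideanMetric (EuclideanSpace ℝ (Fin 3))).edist isRiemannian_euclideanMetric x y ≤ r}) ∧
    ContMDiff (𝓡 3) 𝓘(ℝ, ℝ) ∞ (gaussianPotential : EuclideanSpace ℝ (Fin 3) → ℝ) ∧
    (∀ (x : EuclideanSpace ℝ (Fin 3)) (X Y : TangentSpace (𝓡 3) x),
      (euclideanMetric (EuclideanSpace ℝ (Fin 3))).ricci x X Y +
          (euclideanMetric (EuclideanSpace ℝ (Fin 3))).hessian gaussianPotential x X Y =
        (1 / 2 : ℝ) * (euclideanMetric (EuclideanSpace ℝ (Fin 3))).val x X Y) ∧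
    (∀ x : EuclideanSpace ℝ (Fin 3),
      (euclideanMetric (EuclideanSpace ℝ (Fin 3))).scalarCurvature x +
        (euclideanMetric (EuclideanSpace ℝ (Fin 3))).gradSq gaussianPotential x =
          gaussianPotential x) := by
  refine ⟨isCompact_setOf_edist_euclideanMetric_le, contDiff_gaussianPotential.contMDiff,
    fun x X Y ↦ ?_, fun x ↦ ?_⟩
  · rw [ricci_euclideanMetric, hessian_gaussianPotential, euclideanMetric_apply]
    simp only [LinearMap.zero_apply, zero_add]
    -- the two inner products live on `TangentSpace (𝓡 3) x = ℝ³` (defeq, not syntactically equal)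
    ring_nf
    rfl
  · rw [scalarCurvature_euclideanMetric, gradSq_gaussianPotential, zero_add]

/-- **The Gaussian soliton realises case (o) with the stated constant**: on `(ℝ³, δ, |x|²/4)`,
`R ≡ 0` and `∫⁻ e^{-φ} dV_δ = 8π√π = (4π)^{3/2}` for the tree's Riemannian measure
(Cao–Hamilton–Ilmanen 2004, §3, `Θ(ℝⁿ) = 1`). [cite: CaoHamiltonIlmanen2004, §3] -/
theorem gaussianSoliton_three_modelData :
    (∀ x : EuclideanSpace ℝ (Fin 3),
      (euclideanMetric (EuclideanSpace ℝ (Fin 3))).scalarCurvature x = 0) ∧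
    ∫⁻ x, ENNReal.ofReal (Real.exp (-gaussianPotential x))
        ∂(riemannianMeasure ((euclideanMetric (EuclideanSpace ℝ (Fin 3))).toContMDiffRiemannianMetric
          isRiemannian_euclideanMetric)) =
      ENNReal.ofReal (8 * π * sqrt π) := by
  refine ⟨scalarCurvature_euclideanMetric, ?_⟩
  rw [riemannianMeasure_euclideanMetric]
  have h := lintegral_exp_neg_norm_sub_sq_div_four (0 : EuclideanSpace ℝ (Fin 3))
  simp only [sub_zero] at h
  simpa only [gaussianPotential] using h

end ThreeShrinker

end Literature.Geometry.Riemannian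

end
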